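import Summits.NavierStokesRegularity.OSWSelfSimilar.SheetRTimeShiftModeEnergy
import HarnessLib

/-!
# SHEET-ℝ: item (P6) of the Z3-SR-SPEC spectral certificate, assembled — `σ = 1` is an exact eigenvalue of `−DG(Ω)` with
# eigenvector the T-shift mode `Ω + ½ξΩ′ ∈ E`, for the certified-zero data shape

HONEST FRAMING (cell ns-blowup GROUP B / zone Z3, case Z3-SR-SPEC, PREREG-SHEET-R-SPEC P4 (ii) item (P6); 1-D MODEL — the
viscous gCLM / OSW sheet-ℝ profile equation; not Euler, not NS; «violates: none — MODEL»). Nothing here asserts that a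
profile exists: every theorem is an implication from a strong (or `E`-weak) zero.

(P6a) = `SheetRTimeShiftMode.linearised_timeShiftMode_eq_neg` (pointwise `DG(Ω)[v] = −v`, `v = Ω + ½ξΩ′`, for a `C³` strong
zero in the decay class `Ω, ξΩ′ ∈ L¹`, `|Ω″| ≤ M`, `|Ω′| ≤ C/(1+ξ²)`); (P6b) = `SheetRTimeShiftModeEnergy.timeShiftMode_mem_energyClass`
(`v ∈ E = odd H¹_{L²+ξ²}`). THIS FILE: `decayClass` — the decay class FOLLOWS from the energy class for an odd `C²` strong zero
(`∫(1+ξ²)²(Ω′² + Ω″²) < ∞` by `weighted_level_two`, `Ω‴ ∈ L²` from the differentiated equation, Agmon for `Ω″ ∈ H¹` and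
`(1+ξ²)Ω′ ∈ H¹`); `timeShiftMode_eigen_and_energy` — (P6a) ∧ (P6b) on the strong-zero data shape (odd `C²` pointwise zero of
`Ω + ½ξΩ′ + a𝒰Ω·Ω′ − HΩ·Ω − νΩ″`, `ν > 0`, `∫(L²+ξ²)Ω² < ∞`, `∫(L²+ξ²)Ω′² < ∞`); `timeShiftMode_eigen_and_energy_of_weakZero` —
the same on the certificate's literal `E`-weak zero `Ω = ∫₀Ω₁` (composition with the bridge `SheetRWeakToStrong`).
[folklore] 1-D calculus; MODEL-support, no NS content; no number of any certificate moves.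
-/

noncomputable section

namespace Summit.NavierStokesRegularity.OSWSelfSimilar
namespace SheetRTimeShiftModeAssembly

open _root_.MeasureTheory _root_.Set _root_.Filter Literature.Analysis.Fourier SheetRWeakProfilePV
  SheetRProfileRegularity SheetRTimeShiftModeEnergy
open scoped Real Topology ENNReal ContDiff

variable {a ν L : ℝ} {Ω : ℝ → ℝ}

/-! ### §1 The decay class of (P6a) from the energy class -/

/-- `2|y·d| ≤ (1+y²)⁻¹ + (1+y²)²d²`. [folklore] -/
theorem two_mul_abs_le (y d : ℝ) : 2 * |y * d| ≤ (1 + y ^ 2)⁻¹ + (1 + y ^ 2) ^ 2 * d ^ 2 := by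
  have ht : 0 < 1 + y ^ 2 := by positivity
  have key : 2 * (|y| / (1 + y ^ 2)) * ((1 + y ^ 2) * |d|) ≤
      (|y| / (1 + y ^ 2)) ^ 2 + ((1 + y ^ 2) * |d|) ^ 2 := two_mul_le_add_sq _ _
  have e1 : 2 * (|y| / (1 + y ^ 2)) * ((1 + y ^ 2) * |d|) = 2 * |y * d| := by
    rw [abs_mul]; field_simp
  have e2 : (|y| / (1 + y ^ 2)) ^ 2 ≤ (1 + y ^ 2)⁻¹ := by
    rw [div_pow, sq_abs, pow_two (1 + y ^ 2), ← div_div, div_le_iff₀ ht, inv_mul_cancel₀ ht.ne']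
    rw [div_le_one ht]; nlinarith
  have e3 : ((1 + y ^ 2) * |d|) ^ 2 = (1 + y ^ 2) ^ 2 * d ^ 2 := by rw [mul_pow, sq_abs]
  linarith [key, e1, e2, e3]

/-- **The (P6a) decay class from the energy class.** For an odd energy-class `C²` strong zero (`ν > 0`): `Ω ∈ C³`,
`Ω ∈ L¹`, `ξΩ′ ∈ L¹`, `Ω″` is bounded and `|Ω′(ξ)| ≤ C/(1+ξ²)` — the hypotheses of
`SheetRTimeShiftMode.linearised_timeShiftMode_eq_neg` (level-2 weights + Agmon for `Ω″ ∈ H¹` and `(1+ξ²)Ω′ ∈ H¹`).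
MODEL statement; not NS. [folklore] -/
theorem decayClass (hL : 0 < L) (hν : 0 < ν) (hΩ : ContDiff ℝ 2 Ω) (hodd : ∀ y, Ω (-y) = -Ω y)
    (hw0 : Integrable fun y => (L ^ 2 + y ^ 2) * Ω y ^ 2)
    (hw1 : Integrable fun y => (L ^ 2 + y ^ 2) * deriv Ω y ^ 2)
    (hG : ∀ X, Ω X + 1 / 2 * X * deriv Ω X + a * (∫ s in (0 : ℝ)..X, hilbertTransform Ω s) * deriv Ω X
      - hilbertTransform Ω X * Ω X - ν * iteratedDeriv 2 Ω X = 0) :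
    ContDiff ℝ 3 Ω ∧ Integrable Ω ∧ (Integrable fun y => y * deriv Ω y) ∧
      (∃ M, ∀ y, |deriv (deriv Ω) y| ≤ M) ∧ ∃ C, ∀ y, |deriv Ω y| ≤ C / (1 + y ^ 2) := by
  have hν0 : ν ≠ 0 := hν.ne'
  have hΩ1 : ContDiff ℝ 1 Ω := hΩ.of_le (by norm_num)
  have hΩ3 := contDiff_three hL hν0 hΩ hw0 hw1 hG
  obtain ⟨hΩi, hΩ2, -, hΩ'2, -, hxΩ'⟩ := basic hL hΩ1 hw0 hw1
  obtain ⟨hH1, -, -, -, hH'c, hH'2, -⟩ := hilbert_basic hL hΩ hodd hw0 hw1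
  obtain ⟨S, B, U₀, hS, hB, hU⟩ := exists_bounds hL hΩ hodd hw0 hw1
  obtain ⟨h2, h2'⟩ := weighted_level_two hL hν hΩ hodd hw0 hw1 hG
  have hΩ''2 := memLp_two_deriv_two hL hν0 hΩ hodd hw0 hw1 hG
  have hHc := hH1.continuous
  have hΩc := hΩ.continuous
  have hΩ'1 : ContDiff ℝ 1 (deriv Ω) := (contDiff_succ_iff_deriv.1 (hΩ : ContDiff ℝ (1 + 1) Ω)).2.2
  have hΨ : ContDiff ℝ 2 (deriv Ω) := (contDiff_succ_iff_deriv.1 (hΩ3 : ContDiff ℝ (2 + 1) Ω)).2.2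
  have hΩ''1 : ContDiff ℝ 1 (deriv (deriv Ω)) :=
    (contDiff_succ_iff_deriv.1 (hΨ : ContDiff ℝ (1 + 1) (deriv Ω))).2.2
  have hΩ'c : Continuous (deriv Ω) := hΩ'1.continuous
  have hΩ''c : Continuous (deriv (deriv Ω)) := hΩ''1.continuous
  have hΩ'''c : Continuous (deriv (deriv (deriv Ω))) := hΩ''1.continuous_deriv le_rfl
  have hd1 : ∀ y, HasDerivAt Ω (deriv Ω y) y := fun y => ((hΩ1.differentiable one_ne_zero) y).hasDerivAt
  have hd2 : ∀ y, HasDerivAt (deriv Ω) (deriv (deriv Ω) y) y :=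
    fun y => ((hΩ'1.differentiable one_ne_zero) y).hasDerivAt
  have hd3 : ∀ y, HasDerivAt (deriv (deriv Ω)) (deriv (deriv (deriv Ω)) y) y :=
    fun y => ((hΩ''1.differentiable one_ne_zero) y).hasDerivAt
  -- `ξΩ′ ∈ L¹`
  have hξ : Integrable fun y => y * deriv Ω y := by
    refine ((integrable_inv_one_add_sq.add h2).div_const 2).mono' ((continuous_id.mul hΩ'c).aestronglyMeasurable)
      (Eventually.of_forall fun y => ?_)
    rw [Real.norm_eq_abs]
    simp only [Pi.add_apply]
    have := two_mul_abs_le y (deriv Ω y)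
    linarith
  -- `ξΩ″ ∈ L²`, `(1+ξ²)Ω″ ∈ L²`, `Ω` bounded
  have hΩbd : ∀ y, |Ω y| ≤ Real.sqrt S := fun y => by
    rw [← Real.sqrt_sq_eq_abs]
    refine Real.sqrt_le_sqrt ?_
    nlinarith [hS y, sq_nonneg y, mul_nonneg (sq_nonneg y) (sq_nonneg (Ω y))]
  have hxΩ'' : MemLp (fun y => y * deriv (deriv Ω) y) 2 := by
    have hm : AEStronglyMeasurable (fun y => y * deriv (deriv Ω) y) volume :=
      (continuous_id.mul hΩ''c).aestronglyMeasurable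
    rw [memLp_two_iff_integrable_sq hm]
    refine h2'.mono' (hm.pow 2) (Eventually.of_forall fun y => ?_)
    rw [Real.norm_eq_abs, abs_of_nonneg (sq_nonneg _)]
    nlinarith [sq_nonneg (deriv (deriv Ω) y), sq_nonneg y, mul_nonneg (sq_nonneg y) (sq_nonneg (deriv (deriv Ω) y)),
      mul_nonneg (mul_nonneg (sq_nonneg y) (sq_nonneg y)) (sq_nonneg (deriv (deriv Ω) y))]
  have hwΩ'' : MemLp (fun y => (1 + y ^ 2) * deriv (deriv Ω) y) 2 := by
    have hm : AEStronglyMeasurable (fun y => (1 + y ^ 2) * deriv (deriv Ω) y) volume :=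
      Continuous.aestronglyMeasurable (by fun_prop)
    rw [memLp_two_iff_integrable_sq hm]
    exact h2'.congr (Eventually.of_forall fun y => by ring)
  have hwΩ' : MemLp (fun y => (1 + y ^ 2) * deriv Ω y) 2 := by
    have hm : AEStronglyMeasurable (fun y => (1 + y ^ 2) * deriv Ω y) volume :=
      Continuous.aestronglyMeasurable (by fun_prop)
    rw [memLp_two_iff_integrable_sq hm]
    exact h2.congr (Eventually.of_forall fun y => by ring)
  -- `Ω‴ ∈ L²` from the differentiated equation
  have hEq := deriv_three_eq hL hν0 hΩ hodd hw0 hw1 hG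
  have hUc : Continuous (fun Y => ∫ s in (0 : ℝ)..Y, hilbertTransform Ω s) :=
    (velocity_contDiff_one hHc).continuous
  have m1 : MemLp (fun ξ => (∫ s in (0 : ℝ)..ξ, hilbertTransform Ω s) * deriv (deriv Ω) ξ) 2 :=
    memLp_two_bdd_mul hUc hU hΩ''2
  have m2 : MemLp (fun ξ => hilbertTransform Ω ξ * deriv Ω ξ) 2 := memLp_two_bdd_mul hHc hB hΩ'2
  have m3 : MemLp (fun ξ => Ω ξ * hilbertTransform (deriv Ω) ξ) 2 := memLp_two_bdd_mul hΩc hΩbd hH'2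
  have m : MemLp (fun ξ => (1 / ν) * (1 / 2 * (ξ * deriv (deriv Ω) ξ)
      + a * ((∫ s in (0 : ℝ)..ξ, hilbertTransform Ω s) * deriv (deriv Ω) ξ)
      + 3 / 2 * deriv Ω ξ + (a - 1) * (hilbertTransform Ω ξ * deriv Ω ξ)
      - Ω ξ * hilbertTransform (deriv Ω) ξ)) 2 :=
    (((((hxΩ''.const_mul _).add (m1.const_mul a)).add (hΩ'2.const_mul _)).add (m2.const_mul _)).sub m3).const_mul _
  have hΩ'''2 : MemLp (deriv (deriv (deriv Ω))) 2 := by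
    refine m.ae_eq (Eventually.of_forall fun ξ => ?_)
    have h := hEq ξ
    field_simp
    linarith
  -- Agmon for `Ω″` and for `(1+ξ²)Ω′`
  have hA2 := sq_le_of_hasDerivAt hd3 hΩ'''c hΩ''2 hΩ'''2
  have hdf : ∀ y, HasDerivAt (fun s => (1 + s ^ 2) * deriv Ω s)
      (2 * y * deriv Ω y + (1 + y ^ 2) * deriv (deriv Ω) y) y := fun y => by
    have hq : HasDerivAt (fun s : ℝ => 1 + s ^ 2) (2 * y) y := by
      simpa using ((hasDerivAt_id y).pow 2).const_add (1 : ℝ)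
    have h := hq.mul (hd2 y)
    have hfun : ((fun s : ℝ => 1 + s ^ 2) * deriv Ω : ℝ → ℝ) = fun s => (1 + s ^ 2) * deriv Ω s := by
      funext s; simp only [Pi.mul_apply]
    rw [hfun] at h
    exact h.congr_deriv (by ring)
  have hf'2 : MemLp (fun y => 2 * y * deriv Ω y + (1 + y ^ 2) * deriv (deriv Ω) y) 2 := by
    have := (hxΩ'.const_mul (2 : ℝ)).add hwΩ''
    refine this.ae_eq (Eventually.of_forall fun y => ?_)
    simp only [Pi.add_apply]; ring
  have hA1 := sq_le_of_hasDerivAt hdf (by fun_prop) hwΩ' hf'2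
  set C₂ : ℝ := 2 * ∫ y, |(1 + y ^ 2) * deriv Ω y * (2 * y * deriv Ω y + (1 + y ^ 2) * deriv (deriv Ω) y)|
  refine ⟨hΩ3, hΩi, hξ, ⟨Real.sqrt (2 * ∫ y, |deriv (deriv Ω) y * deriv (deriv (deriv Ω)) y|), fun y => ?_⟩,
    ⟨Real.sqrt C₂, fun y => ?_⟩⟩
  · rw [← Real.sqrt_sq_eq_abs]
    exact Real.sqrt_le_sqrt (hA2 y)
  · have ht : 0 < 1 + y ^ 2 := by positivity
    rw [le_div_iff₀ ht, ← abs_of_pos ht, ← abs_mul, ← Real.sqrt_sq_eq_abs, mul_comm]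
    exact Real.sqrt_le_sqrt (hA1 y)

/-- **(P6) OF THE Z3-SR-SPEC CERTIFICATE, ASSEMBLED.** Let `Ω ∈ C²` be an ODD energy-class strong zero of the sheet-ℝ
profile map — `Ω(X) + ½XΩ′(X) + a·𝒰Ω(X)·Ω′(X) − HΩ(X)·Ω(X) − ν·Ω″(X) = 0` at every `X`, `∫(L²+ξ²)Ω² < ∞`,
`∫(L²+ξ²)Ω′² < ∞` (`ν > 0`, `L > 0`; the data shape delivered by `SheetRWeakToStrong` for the certificate's `E`-weak zero).
Then the T-shift mode `v = Ω + ½ξΩ′` satisfies, at every `X`,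
`DG(Ω)[v](X) := v + ½X·v′ + a·(𝒰v·Ω′ + 𝒰Ω·v′) − Hv·Ω − HΩ·v − ν·v″ = −v(X)` (`σ = 1` is an exact eigenvalue of `−DG(Ω)`,
`SheetRTimeShiftMode.linearised_timeShiftMode_eq_neg` with its decay hypotheses DISCHARGED by `decayClass`), AND `v` is odd
with `∫(L²+ξ²)v² < ∞`, `∫(L²+ξ²)v′² < ∞`, i.e. `v ∈ E = odd H¹_{L²+ξ²}`. MODEL statement (1-D viscous gCLM sheet); not NS;
nothing asserts that such an `Ω` exists and no number of any certificate moves. [folklore] -/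
theorem timeShiftMode_eigen_and_energy {v : ℝ → ℝ} (hL : 0 < L) (hν : 0 < ν) (hΩ : ContDiff ℝ 2 Ω)
    (hodd : ∀ y, Ω (-y) = -Ω y)
    (hw0 : Integrable fun y => (L ^ 2 + y ^ 2) * Ω y ^ 2)
    (hw1 : Integrable fun y => (L ^ 2 + y ^ 2) * deriv Ω y ^ 2)
    (hG : ∀ X, Ω X + 1 / 2 * X * deriv Ω X + a * (∫ s in (0 : ℝ)..X, hilbertTransform Ω s) * deriv Ω X
      - hilbertTransform Ω X * Ω X - ν * iteratedDeriv 2 Ω X = 0)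
    (hv : v = fun ξ => Ω ξ + 1 / 2 * ξ * deriv Ω ξ) :
    (∀ X, v X + 1 / 2 * X * deriv v X
        + a * ((∫ s in (0 : ℝ)..X, hilbertTransform v s) * deriv Ω X
          + (∫ s in (0 : ℝ)..X, hilbertTransform Ω s) * deriv v X)
        - hilbertTransform v X * Ω X - hilbertTransform Ω X * v X - ν * iteratedDeriv 2 v X = -v X) ∧
      (∀ y, v (-y) = -v y) ∧ (Integrable fun y => (L ^ 2 + y ^ 2) * v y ^ 2) ∧
      Integrable fun y => (L ^ 2 + y ^ 2) * deriv v y ^ 2 := by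
  obtain ⟨hΩ3, hΩi, hξ, ⟨M, hM⟩, ⟨C, hC⟩⟩ := decayClass hL hν hΩ hodd hw0 hw1 hG
  exact ⟨SheetRTimeShiftMode.linearised_timeShiftMode_eq_neg hΩ3 hΩi hξ hM hC hG hv,
    timeShiftMode_mem_energyClass hL hν hΩ hodd hw0 hw1 hG hv⟩

/-- **(P6) on the certificate's literal data shape (the `E`-weak zero).** Let `Ω = ∫₀^ξ Ω₁` be ODD with `Ω₁` a.e.-strongly
measurable, `∫(L²+ξ²)Ω² < ∞`, `∫(L²+ξ²)Ω₁² < ∞` (`Ω ∈ E`, `L > 0`), `ν > 0`, and assume the weak profile equation (W) of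
`SheetRWeakToStrong` against all `C_c^∞` tests. Then `Ω ∈ C³` is a pointwise zero of the profile map and the T-shift mode
`v = Ω + ½ξΩ′` is an eigenvector of `−DG(Ω)` for `σ = 1` (pointwise identity) lying in `E` (odd, `∫(L²+ξ²)(v² + v′²) < ∞`).
Composition of the bridge `SheetRWeakToStrong.hasDerivAt_of_weakZero` / `contDiff_two_and_strongZero_of_weakZero` with
`timeShiftMode_eigen_and_energy`. MODEL statement; no profile is asserted to exist. [folklore] -/
theorem timeShiftMode_eigen_and_energy_of_weakZero {Ω₁ v : ℝ → ℝ} (hL : 0 < L) (hν : 0 < ν)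
    (hΩ : ∀ x, Ω x = ∫ s in (0 : ℝ)..x, Ω₁ s) (hodd : ∀ y, Ω (-y) = -Ω y)
    (hΩ₁m : AEStronglyMeasurable Ω₁ volume)
    (hwΩ : Integrable fun y => (L ^ 2 + y ^ 2) * Ω y ^ 2) (hwΩ₁ : Integrable fun y => (L ^ 2 + y ^ 2) * Ω₁ y ^ 2)
    (hweak : ∀ ψ : ℝ → ℝ, ContDiff ℝ ∞ ψ → HasCompactSupport ψ →
      (∫ x, (Ω x + 1 / 2 * x * Ω₁ x + a * (∫ s in (0 : ℝ)..x, hilbertTransform Ω s) * Ω₁ x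
        - hilbertTransform Ω x * Ω x) * ψ x) + ν * ∫ x, Ω₁ x * deriv ψ x = 0)
    (hv : v = fun ξ => Ω ξ + 1 / 2 * ξ * deriv Ω ξ) :
    (ContDiff ℝ 3 Ω ∧ ∀ X : ℝ, Ω X + 1 / 2 * X * deriv Ω X
      + a * (∫ s in (0 : ℝ)..X, hilbertTransform Ω s) * deriv Ω X
      - hilbertTransform Ω X * Ω X - ν * iteratedDeriv 2 Ω X = 0) ∧
    (∀ X, v X + 1 / 2 * X * deriv v X
        + a * ((∫ s in (0 : ℝ)..X, hilbertTransform v s) * deriv Ω X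
          + (∫ s in (0 : ℝ)..X, hilbertTransform Ω s) * deriv v X)
        - hilbertTransform v X * Ω X - hilbertTransform Ω X * v X - ν * iteratedDeriv 2 v X = -v X) ∧
      (∀ y, v (-y) = -v y) ∧ (Integrable fun y => (L ^ 2 + y ^ 2) * v y ^ 2) ∧
      Integrable fun y => (L ^ 2 + y ^ 2) * deriv v y ^ 2 := by
  have hν0 : ν ≠ 0 := hν.ne'
  have hΩ₁2 : MemLp Ω₁ 2 := SheetRWeakToStrong.memLp_two_of_weighted_sq hL hΩ₁m hwΩ₁
  have hΩ' : ∀ x, Ω x = Ω 0 + ∫ s in (0 : ℝ)..x, Ω₁ s := fun x => by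
    rw [hΩ x, hΩ 0, intervalIntegral.integral_same, zero_add]
  have hΩc : Continuous Ω := continuous_of_primitive hΩ' (intervalIntegrable_of_memLp_two hΩ₁2)
  have hΩi : Integrable Ω := SheetRWeightedEmbeddings.integrable_of_weighted_sq hL hΩc.aestronglyMeasurable hwΩ
  have hΩ2 : MemLp Ω 2 := SheetRWeakToStrong.memLp_two_of_weighted_sq hL hΩc.aestronglyMeasurable hwΩ
  obtain ⟨hC2, hG⟩ := SheetRWeakToStrong.contDiff_two_and_strongZero_of_weakZero hν0 hΩ' hΩ₁2 hΩi hΩ2 hweak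
  -- `Ω′ = Ω₁` a.e., so the energy datum transfers to `deriv Ω`
  obtain ⟨c, hae, hder⟩ := SheetRWeakToStrong.hasDerivAt_of_weakZero hν0 hΩ' hΩ₁2 hΩi hΩ2 hweak
  have hae' : ∀ᵐ x : ℝ, Ω₁ x = deriv Ω x := by
    filter_upwards [hae] with x hx
    rw [hx, (hder x).deriv]
  have hw1 : Integrable fun y => (L ^ 2 + y ^ 2) * deriv Ω y ^ 2 := by
    refine hwΩ₁.congr ?_
    filter_upwards [hae'] with x hx
    rw [hx]
  have hΩ3 := contDiff_three hL hν0 hC2 hwΩ hw1 hG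
  exact ⟨⟨hΩ3, hG⟩, timeShiftMode_eigen_and_energy hL hν hC2 hodd hwΩ hw1 hG hv⟩

/-! ### §3 The EVEN companion: the translation mode `Ω′` lies in the even zero-mass energy class `E⁺₀` -/

/-- **Even (P6b): the translation mode is in `E⁺₀`.** For an odd energy-class `C²` strong zero of the sheet-ℝ profile map
(`ν > 0`, `L > 0`) the translation mode `Ω′` is EVEN, satisfies `∫(L²+ξ²)Ω′² < ∞` and `∫(L²+ξ²)Ω″² < ∞` (i.e.
`Ω′ ∈ E⁺ = even H¹_{L²+ξ²}`, by `weighted_level_two`), and has ZERO MASS `∫Ω′ = 0` — the `E⁺₀`-membership input of the even-class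
spectral design (companion of cert-1's `SheetRTranslationMode`: `−DG(Ω)[Ω′] = ½·Ω′` in the covariant gauge). MODEL statement; not NS;
nothing asserts that such an `Ω` exists. [folklore] -/
theorem translationMode_mem_evenEnergyClass (hL : 0 < L) (hν : 0 < ν) (hΩ : ContDiff ℝ 2 Ω)
    (hodd : ∀ y, Ω (-y) = -Ω y)
    (hw0 : Integrable fun y => (L ^ 2 + y ^ 2) * Ω y ^ 2)
    (hw1 : Integrable fun y => (L ^ 2 + y ^ 2) * deriv Ω y ^ 2)
    (hG : ∀ X, Ω X + 1 / 2 * X * deriv Ω X + a * (∫ s in (0 : ℝ)..X, hilbertTransform Ω s) * deriv Ω X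
      - hilbertTransform Ω X * Ω X - ν * iteratedDeriv 2 Ω X = 0) :
    (∀ y, deriv Ω (-y) = deriv Ω y) ∧ (Integrable fun y => (L ^ 2 + y ^ 2) * deriv Ω y ^ 2) ∧
      (Integrable fun y => (L ^ 2 + y ^ 2) * deriv (deriv Ω) y ^ 2) ∧ ∫ y, deriv Ω y = 0 := by
  have hΩ1 : ContDiff ℝ 1 Ω := hΩ.of_le (by norm_num)
  obtain ⟨hΩi, -, hΩ'i, -, -, -⟩ := basic hL hΩ1 hw0 hw1
  obtain ⟨-, h2'⟩ := weighted_level_two hL hν hΩ hodd hw0 hw1 hG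
  have hd1 : ∀ y, HasDerivAt Ω (deriv Ω y) y := fun y => ((hΩ1.differentiable one_ne_zero) y).hasDerivAt
  have hΩ''c : Continuous (deriv (deriv Ω)) :=
    ((contDiff_succ_iff_deriv.1 (hΩ : ContDiff ℝ (1 + 1) Ω)).2.2).continuous_deriv le_rfl
  refine ⟨deriv_even_of_odd hodd, hw1, ?_, integral_eq_zero_of_hasDerivAt_of_integrable hd1 hΩ'i hΩi⟩
  have hm : AEStronglyMeasurable (fun y => (L ^ 2 + y ^ 2) * deriv (deriv Ω) y ^ 2) volume :=
    Continuous.aestronglyMeasurable (by fun_prop)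
  refine (h2'.const_mul (L ^ 2 + 1)).mono' hm (Eventually.of_forall fun y => ?_)
  rw [Real.norm_eq_abs, abs_of_nonneg (by positivity)]
  have hwt : L ^ 2 + y ^ 2 ≤ (L ^ 2 + 1) * (1 + y ^ 2) ^ 2 := by
    nlinarith [sq_nonneg y, sq_nonneg L, mul_nonneg (sq_nonneg L) (sq_nonneg y), mul_nonneg (sq_nonneg y) (sq_nonneg y)]
  calc (L ^ 2 + y ^ 2) * deriv (deriv Ω) y ^ 2 ≤ (L ^ 2 + 1) * (1 + y ^ 2) ^ 2 * deriv (deriv Ω) y ^ 2 := by gcongr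
    _ = (L ^ 2 + 1) * ((1 + y ^ 2) ^ 2 * deriv (deriv Ω) y ^ 2) := by ring

/-- **Even (P6b) on the certificate's literal `E`-weak zero.** For the odd `E`-weak zero `Ω = ∫₀Ω₁` of `SheetRWeakToStrong`
(`Ω₁` a.e.-strongly measurable, `∫(L²+ξ²)Ω² < ∞`, `∫(L²+ξ²)Ω₁² < ∞`, weak profile equation (W), `ν > 0`, `L > 0`): the
translation mode `Ω′` is even with `∫(L²+ξ²)(Ω′² + Ω″²) < ∞` and `∫Ω′ = 0` (`Ω′ ∈ E⁺₀`). MODEL statement; no profile is asserted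
to exist. [folklore] -/
theorem translationMode_mem_evenEnergyClass_of_weakZero {Ω₁ : ℝ → ℝ} (hL : 0 < L) (hν : 0 < ν)
    (hΩ : ∀ x, Ω x = ∫ s in (0 : ℝ)..x, Ω₁ s) (hodd : ∀ y, Ω (-y) = -Ω y)
    (hΩ₁m : AEStronglyMeasurable Ω₁ volume)
    (hwΩ : Integrable fun y => (L ^ 2 + y ^ 2) * Ω y ^ 2) (hwΩ₁ : Integrable fun y => (L ^ 2 + y ^ 2) * Ω₁ y ^ 2)
    (hweak : ∀ ψ : ℝ → ℝ, ContDiff ℝ ∞ ψ → HasCompactSupport ψ →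
      (∫ x, (Ω x + 1 / 2 * x * Ω₁ x + a * (∫ s in (0 : ℝ)..x, hilbertTransform Ω s) * Ω₁ x
        - hilbertTransform Ω x * Ω x) * ψ x) + ν * ∫ x, Ω₁ x * deriv ψ x = 0) :
    (∀ y, deriv Ω (-y) = deriv Ω y) ∧ (Integrable fun y => (L ^ 2 + y ^ 2) * deriv Ω y ^ 2) ∧
      (Integrable fun y => (L ^ 2 + y ^ 2) * deriv (deriv Ω) y ^ 2) ∧ ∫ y, deriv Ω y = 0 := by
  have hν0 : ν ≠ 0 := hν.ne'
  have hΩ₁2 : MemLp Ω₁ 2 := SheetRWeakToStrong.memLp_two_of_weighted_sq hL hΩ₁m hwΩ₁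
  have hΩ' : ∀ x, Ω x = Ω 0 + ∫ s in (0 : ℝ)..x, Ω₁ s := fun x => by
    rw [hΩ x, hΩ 0, intervalIntegral.integral_same, zero_add]
  have hΩc : Continuous Ω := continuous_of_primitive hΩ' (intervalIntegrable_of_memLp_two hΩ₁2)
  have hΩi : Integrable Ω := SheetRWeightedEmbeddings.integrable_of_weighted_sq hL hΩc.aestronglyMeasurable hwΩ
  have hΩ2 : MemLp Ω 2 := SheetRWeakToStrong.memLp_two_of_weighted_sq hL hΩc.aestronglyMeasurable hwΩ
  obtain ⟨hC2, hG⟩ := SheetRWeakToStrong.contDiff_two_and_strongZero_of_weakZero hν0 hΩ' hΩ₁2 hΩi hΩ2 hweak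
  obtain ⟨c, hae, hder⟩ := SheetRWeakToStrong.hasDerivAt_of_weakZero hν0 hΩ' hΩ₁2 hΩi hΩ2 hweak
  have hw1 : Integrable fun y => (L ^ 2 + y ^ 2) * deriv Ω y ^ 2 := by
    refine hwΩ₁.congr ?_
    filter_upwards [hae] with x hx
    rw [hx, (hder x).deriv]
  exact translationMode_mem_evenEnergyClass hL hν hC2 hodd hwΩ hw1 hG

/-! ### §4 Non-triviality of the two gauge modes (the eigenvalue sentences presume an eigenVECTOR) -/

/-- **The T-shift mode of a non-trivial `C¹` profile is non-trivial.** If `Ω ∈ C¹` and `Ω + ½ξΩ′ ≡ 0` then `Ω ≡ 0`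
(`(ξ²Ω)′ = 2ξ(Ω + ½ξΩ′) = 0`, so `ξ²Ω(ξ) = 0·Ω(0) = 0`; at `ξ = 0` the hypothesis itself reads `Ω(0) = 0`). Hence for the
certified (non-trivial) zero the identity `DG(Ω)[v] = −v` of `timeShiftMode_eigen_and_energy` exhibits a genuine eigenvector.
MODEL-support calculus. [folklore] -/
theorem eq_zero_of_timeShiftMode_eq_zero (hΩ : ContDiff ℝ 1 Ω) (hv : ∀ ξ, Ω ξ + 1 / 2 * ξ * deriv Ω ξ = 0) (ξ : ℝ) :
    Ω ξ = 0 := by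
  have hd : ∀ y, HasDerivAt Ω (deriv Ω y) y := fun y => ((hΩ.differentiable one_ne_zero) y).hasDerivAt
  -- `F = ξ²Ω` has zero derivative
  have hF : ∀ y, HasDerivAt (fun s => s ^ 2 * Ω s) 0 y := fun y => by
    have h := (hasDerivAt_pow 2 y).mul (hd y)
    have hfun : ((fun s : ℝ => s ^ 2) * Ω : ℝ → ℝ) = fun s => s ^ 2 * Ω s := by
      funext s; simp only [Pi.mul_apply]
    rw [hfun] at h
    refine h.congr_deriv ?_
    norm_num
    linear_combination (2 * y) * hv y
  have hconst := is_const_of_deriv_eq_zero (f := fun s => s ^ 2 * Ω s) (fun y => (hF y).differentiableAt)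
    (fun y => (hF y).deriv) ξ 0
  rcases eq_or_ne ξ 0 with h0 | h0
  · have := hv 0
    simp only [mul_zero, zero_mul, add_zero] at this
    rw [h0]; exact this
  · have : ξ ^ 2 * Ω ξ = 0 := by simpa using hconst
    exact (mul_eq_zero.1 this).resolve_left (pow_ne_zero 2 h0)

/-- Contrapositive form: a non-trivial `C¹` profile has a non-trivial T-shift mode. [folklore] -/
theorem timeShiftMode_ne_zero {v : ℝ → ℝ} (hΩ : ContDiff ℝ 1 Ω) (hv : v = fun ξ => Ω ξ + 1 / 2 * ξ * deriv Ω ξ)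
    {X₀ : ℝ} (hX₀ : Ω X₀ ≠ 0) : ∃ X, v X ≠ 0 := by
  by_contra h
  push Not at h
  subst hv
  exact hX₀ (eq_zero_of_timeShiftMode_eq_zero hΩ h X₀)

/-- **The translation mode of a non-trivial odd `C¹` profile is non-trivial**: `Ω′ ≡ 0` and `Ω` odd force `Ω ≡ 0`
(constant and `Ω(0) = 0`). MODEL-support calculus. [folklore] -/
theorem translationMode_ne_zero (hΩ : ContDiff ℝ 1 Ω) (hodd : ∀ y, Ω (-y) = -Ω y) {X₀ : ℝ} (hX₀ : Ω X₀ ≠ 0) :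
    ∃ X, deriv Ω X ≠ 0 := by
  by_contra h
  push Not at h
  have hc := is_const_of_deriv_eq_zero (hΩ.differentiable one_ne_zero) h X₀ 0
  have h00 : Ω 0 = 0 := by
    have := hodd 0
    rw [neg_zero] at this
    linarith
  exact hX₀ (hc.trans h00)

end SheetRTimeShiftModeAssembly
end Summit.NavierStokesRegularity.OSWSelfSimilar

end
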